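import Literature.NumberTheory.Automorphic.AdeleGaloisDescent
import HarnessLib

/-!
# The norm group `F^× N(𝔸_E^×)` through the genuine norm `N_{E/F} : 𝕀_E → 𝕀_F`, and
# `N_{E/F} : C_E → C_F`

Topic `NumberTheory/Automorphic`; companion (theorems and one definition, no named fact, no
instance) of `ClassFieldCharacter` (`idelicNormSubgroup`, `normGroup F E = F^× N(𝔸_E^×)`,
`IsTrivialOnNormGroup`, `IsClassFieldCharacter` — all phrased with the Galois norm kept inside
`𝕀_E`), `NormGroupClosedProofs` (the endomorphism `N̄ : C_E → C_E`) and `AdeleGaloisDescent` (the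
idelic norm `AdeleRing.ideleRelNorm F E : 𝕀_E →* 𝕀_F`, `(N y)_E = ∏_σ σ • y`). With the descended
norm available, the norm group and the class-field character take their printed form
(Arthur–Clozel, Ch. 3 §4: "`η` a character of `𝔸^*` vanishing exactly on `F^* N(𝔸_E^*)`";
Cassels–Fröhlich, Ch. VII §2, §5: `N_{L/K} : C_L → C_K` and `C_K / N_{L/K} C_L`):

* `idelicNormSubgroup_eq_range_ideleRelNorm` — `N(𝔸_E^×) ∩ 𝔸_F^× = N_{E/F}(𝕀_E)` (the range of
  the genuine norm); `normGroup_eq_sup_range_ideleRelNorm` — `normGroup F E = Fˣ · N_{E/F}(𝕀_E)`;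
  `mem_normGroup_iff_exists_mul_ideleRelNorm`.
* `HeckeCharacter.isTrivialOnNormGroup_iff_forall_ideleRelNorm` — a Hecke character of `F` is
  trivial on `F^× N(𝔸_E^×)` iff `χ ∘ N_{E/F} = 1`, i.e. iff its base change to `E` is trivial;
  `HeckeCharacter.isClassFieldCharacter_iff` — `η` is a class-field character iff
  `{η = 1} = Fˣ · N_{E/F}(𝕀_E)`.
* `classRelNorm F E : C_E →* C_F` (**definition**, Neukirch's `N_{L|K}` on idele class groups,
  induced by `N_{E/F}` since `N_{E/F}(Eˣ) ⊆ Fˣ`), `classRelNorm_mk`, continuity, and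
  `classBaseChange_classRelNorm : (N_{E/F} c)_E = N̄ c` (compatibility with `classGalNorm` of
  `NormGroupClosedProofs` through the base change `C_F → C_E`); the image of `normGroup F E` in `C_F`
  is the range of `classRelNorm` (`map_normGroup_eq_range_classRelNorm`).

## References

* J. W. S. Cassels, A. Fröhlich (eds.), *Algebraic Number Theory* (1967), Ch. VII (Tate), §2,
  §4–§5. [CasselsFrohlichANT1967]
* J. Arthur, L. Clozel, *Simple algebras, base change, and the advanced theory of the trace
  formula*, Ann. of Math. Stud. 120 (1989), Ch. 3, Thm. 3.1 and §4. [ArthurClozelAMS120]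
-/

noncomputable section

open NumberField IsDedekindDomain

namespace Literature.NumberTheory.Automorphic

section NormGroup

variable (F E : Type) [Field F] [Field E] [Algebra F E] [NumberField F] [NumberField E] [IsGalois F E]

/-- **`N(𝔸_E^×) ∩ 𝔸_F^× = N_{E/F}(𝕀_E)`**: the group of norms of `ClassFieldCharacter` is the range
of the genuine idelic norm. [cite: CasselsFrohlichANT1967, Ch. VII §2] -/
theorem idelicNormSubgroup_eq_range_ideleRelNorm :
    idelicNormSubgroup F E = (AdeleRing.ideleRelNorm F E).range := by
  ext x
  rw [mem_idelicNormSubgroup_iff, MonoidHom.mem_range]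
  constructor
  · rintro ⟨y, hy⟩
    exact ⟨y, AdeleRing.ideleRelNorm_eq_iff.2 hy.symm⟩
  · rintro ⟨y, rfl⟩
    exact ⟨y, (AdeleRing.ideleBaseChange_ideleRelNorm F E y).symm⟩

/-- **`normGroup F E = Fˣ · N_{E/F}(𝕀_E)`** — the printed norm group `F^* N(𝔸_E^*)` of
Arthur–Clozel, Ch. 3 §4. [cite: ArthurClozelAMS120, Ch. 3 §4 (before Thm. 4.2)] -/
theorem normGroup_eq_sup_range_ideleRelNorm :
    normGroup F E =
      Literature.NumberTheory.GaloisRepresentations.principalIdeles F ⊔ (AdeleRing.ideleRelNorm F E).range := by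
  rw [normGroup, idelicNormSubgroup_eq_range_ideleRelNorm]

variable {F E} in
/-- Membership in the norm group: `x ∈ F^× N(𝔸_E^×)` iff `x = a · N_{E/F}(y)` with `a ∈ Fˣ`,
`y ∈ 𝕀_E`. [folklore] -/
theorem mem_normGroup_iff_exists_mul_ideleRelNorm {x : (AdeleRing (𝓞 F) F)ˣ} :
    x ∈ normGroup F E ↔ ∃ a ∈ Literature.NumberTheory.GaloisRepresentations.principalIdeles F,
      ∃ y : (AdeleRing (𝓞 E) E)ˣ, x = a * AdeleRing.ideleRelNorm F E y := by
  rw [normGroup_eq_sup_range_ideleRelNorm, Subgroup.mem_sup]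
  constructor
  · rintro ⟨a, ha, _, ⟨y, rfl⟩, rfl⟩
    exact ⟨a, ha, y, rfl⟩
  · rintro ⟨a, ha, y, rfl⟩
    exact ⟨a, ha, _, ⟨y, rfl⟩, rfl⟩

variable {F E} in
/-- `N_{E/F}(y) ∈ F^× N(𝔸_E^×)`. [folklore] -/
theorem ideleRelNorm_mem_normGroup (y : (AdeleRing (𝓞 E) E)ˣ) :
    AdeleRing.ideleRelNorm F E y ∈ normGroup F E := by
  rw [normGroup_eq_sup_range_ideleRelNorm]
  exact Subgroup.mem_sup_right ⟨y, rfl⟩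

variable {F}

/-- **A Hecke character of `F` is trivial on `F^× N(𝔸_E^×)` iff `χ ∘ N_{E/F} = 1`** (it is
automatically trivial on `Fˣ`). [cite: ArthurClozelAMS120, Ch. 3, Thm. 3.1] -/
theorem _root_.Literature.NumberTheory.GaloisRepresentations.HeckeCharacter.isTrivialOnNormGroup_iff_forall_ideleRelNorm
    (χ : Literature.NumberTheory.GaloisRepresentations.HeckeCharacter F) :
    χ.IsTrivialOnNormGroup E ↔ ∀ y : (AdeleRing (𝓞 E) E)ˣ, χ (AdeleRing.ideleRelNorm F E y) = 1 := by
  constructor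
  · intro h y
    exact h _ (ideleRelNorm_mem_normGroup y)
  · intro h x hx
    obtain ⟨a, ha, y, rfl⟩ := mem_normGroup_iff_exists_mul_ideleRelNorm.1 hx
    rw [map_mul, χ.map_principal ha, h y, one_mul]

/-- A character trivial on the norm group kills every norm: `χ(N_{E/F} y) = 1`. [folklore] -/
theorem _root_.Literature.NumberTheory.GaloisRepresentations.HeckeCharacter.IsTrivialOnNormGroup.apply_ideleRelNorm
    {χ : Literature.NumberTheory.GaloisRepresentations.HeckeCharacter F} (hχ : χ.IsTrivialOnNormGroup E)
    (y : (AdeleRing (𝓞 E) E)ˣ) : χ (AdeleRing.ideleRelNorm F E y) = 1 :=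
  (χ.isTrivialOnNormGroup_iff_forall_ideleRelNorm E).1 hχ y

/-- A class-field character kills every norm: `η(N_{E/F} y) = 1`. [folklore] -/
theorem _root_.Literature.NumberTheory.GaloisRepresentations.HeckeCharacter.IsClassFieldCharacter.apply_ideleRelNorm
    {η : Literature.NumberTheory.GaloisRepresentations.HeckeCharacter F} (hη : η.IsClassFieldCharacter E)
    (y : (AdeleRing (𝓞 E) E)ˣ) : η (AdeleRing.ideleRelNorm F E y) = 1 :=
  hη.isTrivialOnNormGroup.apply_ideleRelNorm E y

/-- **Class-field characters in printed form**: `η` is a class-field character of `E/F` iff it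
"vanishes exactly on `F^* N(𝔸_E^*)`", i.e. `η x = 1 ↔ x = a · N_{E/F}(y)` for some `a ∈ Fˣ`,
`y ∈ 𝕀_E`. [cite: ArthurClozelAMS120, Ch. 3 §4 (before Thm. 4.2)] -/
theorem _root_.Literature.NumberTheory.GaloisRepresentations.HeckeCharacter.isClassFieldCharacter_iff
    (η : Literature.NumberTheory.GaloisRepresentations.HeckeCharacter F) :
    η.IsClassFieldCharacter E ↔ ∀ x : (AdeleRing (𝓞 F) F)ˣ,
      η x = 1 ↔ ∃ a ∈ Literature.NumberTheory.GaloisRepresentations.principalIdeles F,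
        ∃ y : (AdeleRing (𝓞 E) E)ˣ, x = a * AdeleRing.ideleRelNorm F E y := by
  refine forall_congr' fun x => ?_
  rw [mem_normGroup_iff_exists_mul_ideleRelNorm]

end NormGroup

/-! ### The norm on idele class groups `N_{E/F} : C_E → C_F` -/

section ClassGroup

variable (F E : Type) [Field F] [Field E] [Algebra F E] [NumberField F] [NumberField E] [IsGalois F E]

/-- **The norm map on idele class groups `N_{E/F} : C_E →* C_F`**, `[y] ↦ [N_{E/F} y]`, induced by
the idelic norm `AdeleRing.ideleRelNorm` (well defined because `N_{E/F}(Eˣ) ⊆ Fˣ`,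
`AdeleRing.ideleRelNorm_mem_principalIdeles`). This is the `N_{L|K}` of Cassels–Fröhlich, Ch. VII
§2 and Neukirch, Part III (7.8), whose cokernel `C_F / N_{E/F} C_E` is the abelianised Galois group
by class field theory. [cite: CasselsFrohlichANT1967, Ch. VII §2] -/
def classRelNorm : IdeleClassGroup E →* IdeleClassGroup F :=
  QuotientGroup.map (Literature.NumberTheory.GaloisRepresentations.principalIdeles E)
    (Literature.NumberTheory.GaloisRepresentations.principalIdeles F) (AdeleRing.ideleRelNorm F E)
    fun _ hy => AdeleRing.ideleRelNorm_mem_principalIdeles F E hy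

/-- `N_{E/F} [y] = [N_{E/F} y]` (definitional). [folklore] -/
@[simp] theorem classRelNorm_mk (y : Literature.NumberTheory.GaloisRepresentations.ideleGroup E) :
    classRelNorm F E (y : IdeleClassGroup E) = (AdeleRing.ideleRelNorm F E y : IdeleClassGroup F) :=
  rfl

/-- `N_{E/F} : C_E → C_F` is continuous (`AdeleRing.continuous_ideleRelNorm`). [folklore] -/
theorem continuous_classRelNorm : Continuous (classRelNorm F E) :=
  (QuotientGroup.isQuotientMap_mk (Literature.NumberTheory.GaloisRepresentations.principalIdeles E)).continuous_iff.mpr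
    (QuotientGroup.continuous_mk.comp (AdeleRing.continuous_ideleRelNorm F E))

/-- The base change on idele class groups `C_F →* C_E`, `[x] ↦ [x_E]` (base change maps `Fˣ` into
`Eˣ`, `ideleBaseChange_mem_principalIdeles`). Auxiliary, to compare with `classGalNorm`. [folklore] -/
def classBaseChange : IdeleClassGroup F →* IdeleClassGroup E :=
  QuotientGroup.map (Literature.NumberTheory.GaloisRepresentations.principalIdeles F)
    (Literature.NumberTheory.GaloisRepresentations.principalIdeles E) (AdeleRing.ideleBaseChange F E)
    fun _ hx => ideleBaseChange_mem_principalIdeles F E hx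

omit [IsGalois F E] in
/-- `[x] ↦ [x_E]` on classes (definitional). [folklore] -/
@[simp] theorem classBaseChange_mk (x : Literature.NumberTheory.GaloisRepresentations.ideleGroup F) :
    classBaseChange F E (x : IdeleClassGroup F) = (AdeleRing.ideleBaseChange F E x : IdeleClassGroup E) :=
  rfl

/-- **Compatibility with the Galois norm on `C_E`**: `(N_{E/F} c)_E = N̄ c` for every idele class
`c` of `E`, where `N̄ = classGalNorm F E : C_E → C_E` is the endomorphism of `NormGroupClosedProofs`.
[folklore] -/
theorem classBaseChange_classRelNorm (c : IdeleClassGroup E) :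
    classBaseChange F E (classRelNorm F E c) = classGalNorm F E c := by
  induction c using QuotientGroup.induction_on with
  | H y => rw [classRelNorm_mk, classBaseChange_mk, classGalNorm_mk, AdeleRing.ideleBaseChange_ideleRelNorm]

/-- **The norm group in `C_F` is the range of `N_{E/F} : C_E → C_F`**: the image of
`normGroup F E = Fˣ · N_{E/F}(𝕀_E)` in `C_F = 𝕀_F / Fˣ` is `N_{E/F}(C_E)`. [cite: CasselsFrohlichANT1967, Ch. VII §5] -/
theorem map_normGroup_eq_range_classRelNorm :
    (normGroup F E).map (QuotientGroup.mk' (Literature.NumberTheory.GaloisRepresentations.principalIdeles F)) =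
      (classRelNorm F E).range := by
  ext c
  constructor
  · rintro ⟨x, hx, rfl⟩
    obtain ⟨a, ha, y, rfl⟩ := mem_normGroup_iff_exists_mul_ideleRelNorm.1 hx
    refine ⟨(y : IdeleClassGroup E), ?_⟩
    rw [classRelNorm_mk, QuotientGroup.mk'_apply, QuotientGroup.eq, mul_comm a, inv_mul_cancel_left]
    exact ha
  · rintro ⟨c, rfl⟩
    induction c using QuotientGroup.induction_on with
    | H y => exact ⟨AdeleRing.ideleRelNorm F E y, ideleRelNorm_mem_normGroup y, rfl⟩

end ClassGroup

end Literature.NumberTheory.Automorphic
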